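import Summits.BirchSwinnertonDyer.BirchSwinnertonDyer.Theorems.ManinLocalTwoThreeBracketSturmOneSixtyTwoA
import Summits.BirchSwinnertonDyer.BirchSwinnertonDyer.Theorems.ManinLocalTwoThreeBracketSturmOneSixtyTwoB
import Summits.BirchSwinnertonDyer.BirchSwinnertonDyer.Theorems.ManinLocalTwoThreeBracketSturmOneSixtyTwoC
import Summits.BirchSwinnertonDyer.BirchSwinnertonDyer.Theorems.ManinLocalTwoThreeBracketSturmOneSixtyTwoD
import HarnessLib

/-!
# LEVEL 162 = 2·3⁴ COMPLETE, fact-free: `|c| = 1` (hence `3 ∤ c`) for every lattice-optimal `X₀(162)`-datum — conductor exponent FOUR at `3`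

Cell bsd-f2-manin, route `ManinLocalTwoThree`, crux C3 `ManinPrimeToThreeAtNine` (stmt-BirchSwinnertonDyer-22968; `81 ∥ 162`), prover seat p3 gen 26.
The four classes `162a–d` are closed in `…BracketSturmOneSixtyTwoA/B/C/D` (an g55's pinning + this seat's sparse tables and weight-12 certificates at depth 325);
here: the row tetrachotomy `a₅(W) = −3 ∨ a₁₁(W) = −3 ∨ a₁₁(W) = 3 ∨ a₅(W) = 3` and THE HEADLINE **`abs_maninConstant_eq_one_oneSixtyTwo`** — `|c| = 1` for every
globally minimal elliptic `W/ℚ` and EVERY `X₀(162)`-datum with the lattice clause; `not_dvd_maninConstant_oneSixtyTwo`; the crux shape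
`maninPrimeToThreeAtNine_oneSixtyTwo` (`3² ∣ 162 ∧ ∀ …, |c| = 1 ∧ 3 ∤ c`).

HONEST FRAMING: unconditional (standard axioms), no modularity, no CDT, no printed Manin fact, no Cremona table; ONE LEVEL of the C3 domain — nothing
here proves C3 (∀ N), C2, Manin's conjecture or BSD; items 22967/22968 stay OPEN.  No definition, no named fact, no sorry.
[cite: Manin1972, Prop. 1.4] [cite: Sturm1987, Thm. 1] [cite: AgasheRibetStein2006, §§1–2] [cite: CremonaAlgorithms1997, Table 1 (162a–d)]
-/

set_option autoImplicit false
-- lint-debt: the directory name repeats the summit name (sibling precedent `ManinLocalTwoThreeManinConstantNinety.lean`)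
set_option linter.dupNamespace false

noncomputable section

open Complex
open scoped MatrixGroups ModularForm
open ModularForm CongruenceSubgroup
open Literature.NumberTheory.EllipticCurves Literature.NumberTheory.EllipticCurves.ModularForms

namespace Summit.BirchSwinnertonDyer.BirchSwinnertonDyer.Theorems.ManinLocalTwoThree.LevelOneSixtyTwo

open PinningKernel PinningOneSixtyTwo

variable {W : WeierstrassCurve ℚ} [W.IsElliptic]

/-- **The four truth rows**: for every `X₀(162)`-datum, `a₅(W) = −3` (`162a`) or `a₁₁(W) = −3` (`162b`) or `a₁₁(W) = 3` (`162c`) or `a₅(W) = 3` (`162d`).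
[cite: CremonaAlgorithms1997, Table 1 (162a–d)] -/
theorem row_cases (D : ModularParametrizationData W 162) :
    W.LFunction 5 = -3 ∨ W.LFunction 11 = -3 ∨ W.LFunction 11 = 3 ∨ W.LFunction 5 = 3 := by
  haveI : FiniteDimensional ℂ (ModularForm (Gamma0 162) 2) := Module.finite_of_finrank_eq_succ finrank_modularForm_two
  obtain ⟨C, hC, c, hc, htruth, -⟩ := pinning D
  rw [show stages.map Prod.fst = [3, 2, 5, 7, 11, 13, 17, 19, 23, 29, 31] from by decide] at htruth
  have h5 := congrArg (fun l : List (ℕ × ℤ) ↦ (l.getD 2 (0, 0)).2) htruth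
  have h11 := congrArg (fun l : List (ℕ × ℤ) ↦ (l.getD 4 (0, 0)).2) htruth
  simp only [goodCerts, List.mem_cons, List.mem_nil_iff, or_false] at hc
  rcases hc with rfl | rfl | rfl | rfl
  · exact Or.inl (by simpa [truth] using h5)
  · exact Or.inr (Or.inr (Or.inl (by simpa [truth] using h11)))
  · exact Or.inr (Or.inl (by simpa [truth] using h11))
  · exact Or.inr (Or.inr (Or.inr (by simpa [truth] using h5)))

/-- **LEVEL 162 COMPLETE — `|c| = 1` for every globally minimal elliptic `W/ℚ` and every `X₀(162)`-datum with the lattice clause** (the shape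
`LevelManinOne 162`).  No modularity, no CDT, no printed Manin fact, no Cremona table. [cite: Manin1972, Prop. 1.4] [cite: AgasheRibetStein2006, §§1–2] -/
theorem abs_maninConstant_eq_one_oneSixtyTwo (W : WeierstrassCurve ℚ) [W.IsElliptic] [W.IsGloballyMinimal]
    (D : ModularParametrizationData W 162) (hopt : ∀ z ∈ D.L.lattice, ∃ w ∈ periodLattice D.f, z = D.c * w) :
    |D.maninConstant| = 1 := by
  rcases row_cases D with h | h | h | h
  · exact abs_maninConstant_eq_one_a W D h hopt
  · exact abs_maninConstant_eq_one_b W D h hopt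
  · exact abs_maninConstant_eq_one_c W D h hopt
  · exact abs_maninConstant_eq_one_d W D h hopt

/-- **Corollary: no integer `p` with `|p| ≠ 1` — in particular neither `3` nor `2` nor any prime — divides the Manin constant of a
lattice-optimal `X₀(162)`-datum.** [folklore] -/
theorem not_dvd_maninConstant_oneSixtyTwo (W : WeierstrassCurve ℚ) [W.IsElliptic] [W.IsGloballyMinimal]
    (D : ModularParametrizationData W 162) (hopt : ∀ z ∈ D.L.lattice, ∃ w ∈ periodLattice D.f, z = D.c * w)
    {p : ℤ} (hp : p.natAbs ≠ 1) : ¬ p ∣ D.maninConstant := by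
  intro h
  have h1 := abs_maninConstant_eq_one_oneSixtyTwo W D hopt
  have hn : D.maninConstant.natAbs = 1 := by
    rw [Int.abs_eq_natAbs] at h1
    exact_mod_cast h1
  have h2 : p.natAbs ∣ 1 := hn ▸ Int.natAbs_dvd_natAbs.mpr h
  exact hp (Nat.dvd_one.mp h2)

/-- **C3 `ManinPrimeToThreeAtNine` AT THE LEVEL `N = 162`, with NONE of its printed hypotheses**: `3² ∣ 162` and every lattice-optimal
`X₀(162)`-datum of every globally minimal elliptic curve has `|c| = 1` and `3 ∤ c`. [cite: CremonaAlgorithms1997, Table 1 (162a–d)] -/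
theorem maninPrimeToThreeAtNine_oneSixtyTwo : 3 ^ 2 ∣ 162 ∧
    ∀ (W : WeierstrassCurve ℚ) [W.IsElliptic] [W.IsGloballyMinimal] (D : ModularParametrizationData W 162),
      (∀ z ∈ D.L.lattice, ∃ w ∈ periodLattice D.f, z = D.c * w) →
        |D.maninConstant| = 1 ∧ ¬ (3 : ℤ) ∣ D.maninConstant :=
  ⟨by norm_num, fun W _ _ D hopt ↦
    ⟨abs_maninConstant_eq_one_oneSixtyTwo W D hopt, not_dvd_maninConstant_oneSixtyTwo W D hopt (by decide)⟩⟩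

end Summit.BirchSwinnertonDyer.BirchSwinnertonDyer.Theorems.ManinLocalTwoThree.LevelOneSixtyTwo

end
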